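import Literature.Geometry.Lorentzian.GeodesicExistence
import HarnessLib

/-!
# Translation, gluing and extension of geodesics; a completeness criterion

General facts about the geodesics of a `C¹` covariant derivative `cov` on the tangent bundle of a
Hausdorff manifold `M` without boundary (finite-dimensional complete model space), in the
framework of `Literature.Geometry.Lorentzian.Geodesic` (O'Neill, *Semi-Riemannian geometry*
(1983), Ch. 3, pp. 67–69):

* `IsGeodesicOn.comp_sub_const`: a translate `t ↦ γ (t - a)` of a geodesic is a geodesic (the
  case `a = 1` of the affine reparametrisation `IsGeodesicOn.comp_affine`, O'Neill, Def. 20 and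
  the remark before Lemma 22);
* `IsGeodesicOn.piecewise`: two geodesics on open parameter sets `U`, `V` with `U ∩ V` an
  interval, having the same tangent lift at one parameter of `U ∩ V`, glue to a geodesic on
  `U ∪ V` (uniqueness, O'Neill Lemma 23 = `IsGeodesicOn.eqOn_of_velocity_eq_holds`, and locality
  of the geodesic condition, `IsGeodesicOn.congr_holds`);
* `exists_isGeodesic_of_forall_nat`: geodesics with given initial data on `(-n, n)` for every `n`
  assemble to a geodesic on `ℝ` (the exhaustion behind "a maximal geodesic", O'Neill p. 68);
* `isGeodesicallyComplete_of_uniformTime`: **completeness criterion** — if for all initial data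
  `(x, v)` and every time bound `T` there are a set `𝒦 ⊆ TM` of initial data with a *uniform
  existence time* `ε` and an *a priori confinement* of the tangent lifts `(γ t, γ' t)`, `|t| < T`,
  of all geodesics through `(x, v)` to `𝒦`, then `cov` is geodesically complete. This is the
  skeleton of the classical proof that a maximal geodesic with bounded parameter interval leaves
  every compact set of `TM` (O'Neill 1983, Ch. 5, Lemma 8, p. 130; Lee, *Introduction to
  Riemannian Manifolds* (2018), Lemma 6.19 "escape lemma" and Cor. 6.20), run on the supremum of
  the symmetric existence intervals `(-b, b)` instead of on maximal geodesics: near the supremum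
  the geodesic is extended beyond it at both ends by gluing the uniform-time geodesics issuing
  from its tangent lifts, a contradiction.

## References

* B. O'Neill, *Semi-Riemannian geometry with applications to relativity*, Academic Press 1983,
  Ch. 3, Def. 20–Lemma 23 (pp. 67–68, affine parameters, local existence, uniqueness, maximal
  geodesics); Ch. 5, Lemma 8 (p. 130).
* J. M. Lee, *Introduction to Riemannian Manifolds*, 2nd ed., Springer GTM 176 (2018),
  Lemma 6.19 and Cor. 6.20.
-/

noncomputable section

open Bundle Set Filter Metric
open scoped Manifold ContDiff Topology

namespace Literature.Geometry.Lorentzian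

variable {E : Type*} [NormedAddCommGroup E] [NormedSpace ℝ E] {H : Type*} [TopologicalSpace H]
  {I : ModelWithCorners ℝ E H} {M : Type*} [TopologicalSpace M] [ChartedSpace H M]
  [IsManifold I ∞ M]

/-! ### Translation of the parameter -/

omit [IsManifold I ∞ M] in
/-- The velocity of the translate `t ↦ γ (t - a)` at `t` is the velocity of `γ` at `t - a`
(chain rule with the unit-speed translation; both sides are the junk value `0` when `γ` is not
differentiable at `t - a`). O'Neill 1983, Ch. 3, Def. 20 (reparametrisation). [folklore] -/
theorem velocity_comp_sub_const (γ : ℝ → M) (a t : ℝ) :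
    velocity I (fun t ↦ γ (t - a)) t = velocity I γ (t - a) := by
  have hsh : HasMFDerivAt 𝓘(ℝ, ℝ) 𝓘(ℝ, ℝ) (fun t : ℝ ↦ t - a) t (ContinuousLinearMap.id ℝ ℝ) :=
    hasMFDerivAt_iff_hasFDerivAt.2 ((hasFDerivAt_id t).sub_const a)
  have hsh' : HasMFDerivAt 𝓘(ℝ, ℝ) 𝓘(ℝ, ℝ) (fun t : ℝ ↦ t + a) (t - a)
      (ContinuousLinearMap.id ℝ ℝ) :=
    hasMFDerivAt_iff_hasFDerivAt.2 ((hasFDerivAt_id (t - a)).add_const a)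
  by_cases hd : MDifferentiableAt 𝓘(ℝ, ℝ) I γ (t - a)
  · have h' : mfderiv 𝓘(ℝ, ℝ) I (fun t ↦ γ (t - a)) t =
        (mfderiv 𝓘(ℝ, ℝ) I γ (t - a)).comp (ContinuousLinearMap.id ℝ ℝ) :=
      (hd.hasMFDerivAt.comp t hsh).mfderiv
    exact DFunLike.congr_fun h' (1 : ℝ)
  · have hd' : ¬ MDifferentiableAt 𝓘(ℝ, ℝ) I (fun t ↦ γ (t - a)) t := by
      intro h
      apply hd
      have h1 : HasMFDerivAt 𝓘(ℝ, ℝ) I (fun t ↦ γ (t - a)) (t - a + a)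
          (mfderiv 𝓘(ℝ, ℝ) I (fun t ↦ γ (t - a)) t) := by
        rw [sub_add_cancel]
        exact h.hasMFDerivAt
      have h2 := h1.comp (t - a) hsh'
      have h3 : (fun t ↦ γ (t - a)) ∘ (fun t : ℝ ↦ t + a) = γ := by
        ext t'
        simp
      rw [h3] at h2
      exact h2.mdifferentiableAt
    have h0 : mfderiv 𝓘(ℝ, ℝ) I (fun t ↦ γ (t - a)) t = 0 :=
      mfderiv_zero_of_not_mdifferentiableAt hd'
    have h0' : mfderiv 𝓘(ℝ, ℝ) I γ (t - a) = 0 := mfderiv_zero_of_not_mdifferentiableAt hd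
    change mfderiv 𝓘(ℝ, ℝ) I (fun t ↦ γ (t - a)) t (1 : ℝ) = mfderiv 𝓘(ℝ, ℝ) I γ (t - a) (1 : ℝ)
    rw [h0, h0']
    rfl

omit [IsManifold I ∞ M] in
/-- The tangent lift of the translate `t ↦ γ (t - a)` at `t` is the tangent lift of `γ` at
`t - a`. O'Neill 1983, Ch. 3, Def. 20. [folklore] -/
theorem tangentLift_comp_sub_const (γ : ℝ → M) (a t : ℝ) :
    tangentLift I (fun t ↦ γ (t - a)) t = tangentLift I γ (t - a) :=
  TotalSpace.ext rfl (heq_of_eq (velocity_comp_sub_const γ a t))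

variable [FiniteDimensional ℝ E] {cov : CovariantDerivative I E (TangentSpace I : M → Type _)}

/-- **Translates of geodesics are geodesics** (O'Neill 1983, Ch. 3, Def. 20 and the remark
preceding Lemma 22: the parameter of a geodesic is determined up to affine changes; here the
translation `t ↦ t - a`). If `γ` is a geodesic of `cov` on `s`, then `t ↦ γ (t - a)` is a geodesic
on the translated parameter set: its tangent lift is the tangent lift of `γ` composed with the
translation (`tangentLift_comp_sub_const`), and in the canonical-frame formula for the
acceleration the coefficient functions are translated, so that `D/dt` commutes with translation
(`deriv_comp_sub_const`). [cite: ONeill1983, Ch. 3, Def. 20] -/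
theorem IsGeodesicOn.comp_sub_const {γ : ℝ → M} {s : Set ℝ} (h : IsGeodesicOn cov γ s) (a : ℝ) :
    IsGeodesicOn cov (fun t ↦ γ (t - a)) ((fun t ↦ t - a) ⁻¹' s) := by
  have hlift : tangentLift I (fun t ↦ γ (t - a)) = tangentLift I γ ∘ fun t ↦ t - a :=
    funext fun t ↦ tangentLift_comp_sub_const γ a t
  refine ⟨fun t ht ↦ ?_, fun t ht ↦ ?_⟩
  · rw [hlift]
    exact (h.1 _ ht).comp t
      (hasMFDerivAt_iff_hasFDerivAt.2 ((hasFDerivAt_id t).sub_const a)).mdifferentiableAt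
  · have h2 := h.2 _ ht
    rw [covariantDerivAlong_def] at h2 ⊢
    unfold covariantDerivAlongFrame at h2 ⊢
    simp only [velocity_comp_sub_const γ a]
    have hder : ∀ i, deriv (fun t' ↦ (Trivialization.localFrame_coeff I
        (trivializationAt E (TangentSpace I : M → Type _) (γ (t - a))) (Module.finBasis ℝ E) i
        (γ (t' - a))) (velocity I γ (t' - a))) t =
      deriv (fun t' ↦ (Trivialization.localFrame_coeff I
        (trivializationAt E (TangentSpace I : M → Type _) (γ (t - a))) (Module.finBasis ℝ E) i
        (γ t')) (velocity I γ t')) (t - a) := fun i ↦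
      deriv_comp_sub_const (f := fun t' ↦ (Trivialization.localFrame_coeff I
        (trivializationAt E (TangentSpace I : M → Type _) (γ (t - a))) (Module.finBasis ℝ E) i
        (γ t')) (velocity I γ t')) a t
    simp only [hder]
    exact h2

/-! ### Gluing two geodesics -/

/-- **Gluing geodesics** (uniqueness, O'Neill 1983, Ch. 3, Lemma 23, with locality of the
geodesic equation). For a `C¹` connection on a Hausdorff manifold without boundary, let `γ` be a
geodesic on an open set `U` and `β` a geodesic on an open set `V` of parameters such that `U ∩ V`
is an interval containing a parameter `t₁` at which the two tangent lifts agree. Then the curve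
`U.piecewise γ β` (equal to `γ` on `U` and to `β` off `U`) is a geodesic on `U ∪ V`, agreeing with
`γ` on `U` and with `β` on `V`: by uniqueness `γ = β` on `U ∩ V`, so the glued curve equals `β`
on all of `V`, and being a geodesic is local on open sets (`IsGeodesicOn.congr_holds`).
[cite: ONeill1983, Ch. 3, Lemma 23] -/
theorem IsGeodesicOn.piecewise [CompleteSpace E] [T2Space M] [BoundarylessManifold I M]
    [CovariantDerivative.ContMDiffCovariantDerivative cov 1]
    {γ β : ℝ → M} {U V : Set ℝ} (hU : IsOpen U) (hV : IsOpen V) (hUV : (U ∩ V).OrdConnected)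
    (hγ : IsGeodesicOn cov γ U) (hβ : IsGeodesicOn cov β V) {t₁ : ℝ} (ht₁ : t₁ ∈ U ∩ V)
    (h : tangentLift I γ t₁ = tangentLift I β t₁) [DecidablePred (· ∈ U)] :
    IsGeodesicOn cov (U.piecewise γ β) (U ∪ V) ∧ EqOn (U.piecewise γ β) γ U ∧
      EqOn (U.piecewise γ β) β V := by
  have heq : EqOn γ β (U ∩ V) :=
    IsGeodesicOn.eqOn_of_velocity_eq_holds (hU.inter hV) hUV (hγ.mono inter_subset_left)
      (hβ.mono inter_subset_right) ht₁ (congrArg TotalSpace.proj h)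
      (eq_of_heq (TotalSpace.mk.inj h).2)
  have hγ' : EqOn (U.piecewise γ β) γ U := fun t ht ↦ U.piecewise_eq_of_mem γ β ht
  have hβ' : EqOn (U.piecewise γ β) β V := by
    intro t ht
    by_cases htU : t ∈ U
    · rw [U.piecewise_eq_of_mem γ β htU]
      exact heq ⟨htU, ht⟩
    · exact U.piecewise_eq_of_notMem γ β htU
  refine ⟨?_, hγ', hβ'⟩
  have h1 : IsGeodesicOn cov (U.piecewise γ β) U := IsGeodesicOn.congr_holds hγ hU hγ'.symm
  have h2 : IsGeodesicOn cov (U.piecewise γ β) V := IsGeodesicOn.congr_holds hβ hV hβ'.symm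
  exact ⟨fun t ht ↦ ht.elim (h1.1 t) (h2.1 t), fun t ht ↦ ht.elim (h1.2 t) (h2.2 t)⟩

/-- **Extension of a geodesic through one of its tangent lifts.** Let `γ` be a geodesic on the
open interval `(a, b)`, `t₁ ∈ (a, b)`, and let `β` be a geodesic on `(-ε, ε)` whose tangent lift
at `0` is that of `γ` at `t₁`. Then there is a geodesic on `(a, b) ∪ (t₁ - ε, t₁ + ε)` agreeing
with `γ` on `(a, b)` (glue `γ` with the translate `t ↦ β (t - t₁)`, `IsGeodesicOn.piecewise`).
O'Neill 1983, Ch. 3, Lemma 23 and p. 68 (construction of the maximal geodesic).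
[cite: ONeill1983, Ch. 3, Lemma 23] -/
theorem IsGeodesicOn.exists_extend [CompleteSpace E] [T2Space M] [BoundarylessManifold I M]
    [CovariantDerivative.ContMDiffCovariantDerivative cov 1]
    {γ : ℝ → M} {a b : ℝ} (hγ : IsGeodesicOn cov γ (Ioo a b)) {t₁ : ℝ} (ht₁ : t₁ ∈ Ioo a b)
    {β : ℝ → M} {ε : ℝ} (hβ : IsGeodesicOn cov β (Ioo (-ε) ε))
    (h0 : tangentLift I β 0 = tangentLift I γ t₁) :
    ∃ γ' : ℝ → M, IsGeodesicOn cov γ' (Ioo a b ∪ Ioo (t₁ - ε) (t₁ + ε)) ∧ EqOn γ' γ (Ioo a b) := by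
  classical
  have hβ' : IsGeodesicOn cov (fun t ↦ β (t - t₁)) (Ioo (t₁ - ε) (t₁ + ε)) := by
    have h := hβ.comp_sub_const t₁
    refine h.mono fun t ht ↦ ?_
    simp only [mem_preimage, mem_Ioo] at ht ⊢
    constructor <;> linarith [ht.1, ht.2]
  by_cases hε : 0 < ε
  · have ht₁' : t₁ ∈ Ioo a b ∩ Ioo (t₁ - ε) (t₁ + ε) := ⟨ht₁, by constructor <;> linarith⟩
    have hlift : tangentLift I γ t₁ = tangentLift I (fun t ↦ β (t - t₁)) t₁ := by
      rw [tangentLift_comp_sub_const β t₁ t₁, sub_self, h0]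
    obtain ⟨hg, hgγ, -⟩ := hγ.piecewise isOpen_Ioo isOpen_Ioo
      (Set.ordConnected_Ioo.inter Set.ordConnected_Ioo) hβ' ht₁' hlift
    exact ⟨_, hg, hgγ⟩
  · refine ⟨γ, ?_, fun t _ ↦ rfl⟩
    have he : Ioo (t₁ - ε) (t₁ + ε) = ∅ := Ioo_eq_empty (by linarith)
    rw [he, union_empty]
    exact hγ

/-! ### From symmetric intervals to the whole line -/

/-- **Exhaustion.** If for every `n : ℕ` there is a geodesic on `(-(n+1), n+1)` with initial data
`(x, v)` at `0` (a `C¹` connection on a Hausdorff manifold without boundary), then there is a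
geodesic on all of `ℝ` with these initial data: by uniqueness (O'Neill 1983, Ch. 3, Lemma 23)
the geodesics agree on their common intervals, so `t ↦ γ_{⌊|t|⌋} t` is locally one of them,
hence a geodesic (locality, `IsGeodesicOn.congr_holds`). This is the passage to the union of all
geodesics with the given initial data (O'Neill, p. 68, "there is a unique maximal geodesic").
[cite: ONeill1983, Ch. 3, Lemma 23 and p. 68] -/
theorem exists_isGeodesic_of_forall_nat [CompleteSpace E] [T2Space M] [BoundarylessManifold I M]
    [CovariantDerivative.ContMDiffCovariantDerivative cov 1] {x : M} {v : TangentSpace I x}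
    (h : ∀ n : ℕ, ∃ γ : ℝ → M, IsGeodesicOn cov γ (Ioo (-(n + 1 : ℝ)) (n + 1)) ∧ γ 0 = x ∧
      velocity I γ 0 = v) :
    ∃ γ : ℝ → M, IsGeodesic cov γ ∧ γ 0 = x ∧ velocity I γ 0 = v := by
  choose γ hγ h0 hv using h
  -- the geodesics agree on their common intervals
  have hagree : ∀ m n : ℕ, m ≤ n → EqOn (γ m) (γ n) (Ioo (-(m + 1 : ℝ)) (m + 1)) := by
    intro m n hmn
    have hsub : Ioo (-(m + 1 : ℝ)) (m + 1) ⊆ Ioo (-(n + 1 : ℝ)) (n + 1) :=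
      Ioo_subset_Ioo (by linarith [(Nat.cast_le (α := ℝ)).2 hmn])
        (by linarith [(Nat.cast_le (α := ℝ)).2 hmn])
    exact IsGeodesicOn.eqOn_of_velocity_eq_holds isOpen_Ioo Set.ordConnected_Ioo (hγ m)
      ((hγ n).mono hsub) (t₀ := 0) ⟨by linarith, by linarith⟩ (by rw [h0 m, h0 n])
      (by rw [hv m, hv n])
  set Γ : ℝ → M := fun t ↦ γ ⌊|t|⌋₊ t with hΓ_def
  have hmem : ∀ t : ℝ, t ∈ Ioo (-(⌊|t|⌋₊ + 1 : ℝ)) (⌊|t|⌋₊ + 1) := fun t ↦ by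
    have h1 : |t| < ⌊|t|⌋₊ + 1 := Nat.lt_floor_add_one |t|
    constructor <;> linarith [abs_lt.1 h1 |>.1, abs_lt.1 h1 |>.2, neg_abs_le t, le_abs_self t]
  -- near `t₀`, `Γ` is the geodesic `γ N`, `N = ⌊|t₀|⌋ + 1`
  have hloc : ∀ t₀ : ℝ, Γ =ᶠ[𝓝 t₀] γ (⌊|t₀|⌋₊ + 1) := by
    intro t₀
    have hopen : IsOpen {t : ℝ | |t| < |t₀| + 1} := isOpen_lt continuous_abs continuous_const
    filter_upwards [hopen.mem_nhds (show |t₀| < |t₀| + 1 by linarith)] with t ht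
    have hle : ⌊|t|⌋₊ ≤ ⌊|t₀|⌋₊ + 1 := by
      rw [← Nat.floor_add_one (abs_nonneg t₀)]
      exact Nat.floor_le_floor ht.le
    exact hagree _ _ hle (hmem t)
  refine ⟨Γ, ⟨fun t _ ↦ ?_, fun t _ ↦ ?_⟩, ?_, ?_⟩
  · have hN := (hγ (⌊|t|⌋₊ + 1)).1 t ?_
    · exact hN.congr_of_eventuallyEq (tangentLift_eventuallyEq_of_eventuallyEq (hloc t))
    · have h1 := hmem t
      simp only [mem_Ioo, Nat.cast_add, Nat.cast_one] at h1 ⊢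
      constructor <;> linarith
  · rw [covariantDerivAlong_velocity_congr (hloc t)]
    refine (hγ (⌊|t|⌋₊ + 1)).2 t ?_
    have h1 := hmem t
    simp only [mem_Ioo, Nat.cast_add, Nat.cast_one] at h1 ⊢
    constructor <;> linarith
  · simp [hΓ_def, h0]
  · rw [velocity_congr_of_eventuallyEq (hloc 0)]
    exact hv _

/-! ### The completeness criterion -/

/-- **Completeness criterion: uniform existence time plus a priori confinement.** Let `cov` be a
`C¹` connection on a Hausdorff manifold without boundary. Suppose that for all initial data
`(x, v)` and every `T > 0` there are a set `𝒦 ⊆ TM` and `ε > 0` such that (i) every `p ∈ 𝒦` is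
the tangent lift at `0` of a geodesic defined on `(-ε, ε)` (uniform existence time on `𝒦`), and
(ii) every geodesic `γ` on an interval `(a, b) ∋ 0` with `γ 0 = x`, `γ' 0 = v` has
`(γ t, γ' t) ∈ 𝒦` for all `t ∈ (a, b)` with `|t| < T` (a priori confinement). Then `cov` is
geodesically complete. Proof: for fixed `(x, v)` let `S` be the set of `b > 0` for which a
geodesic with these initial data exists on `(-b, b)`; it is nonempty (local existence,
`exists_isGeodesicOn_nhds_zero_holds`) and an initial segment of `(0, ∞)`. If `S` is unbounded,
the geodesics on `(-n, n)` assemble to one on `ℝ` (`exists_isGeodesic_of_forall_nat`). If not,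
let `T* = sup S` and take `𝒦, ε` for `T = T* + 1`; a geodesic on `(-b, b)` with `b` close to
`T*` has its tangent lifts at `±(b - ε/2)` in `𝒦`, so it extends (gluing the uniform-time
geodesics there, `IsGeodesicOn.exists_extend`) to `(-b - ε/2, b + ε/2)`, and `b + ε/2 > T*`
contradicts the choice of `T*`. This is the classical argument that a geodesic with bounded
maximal interval leaves every compact subset of `TM` (O'Neill 1983, Ch. 5, Lemma 8; Lee 2018,
Lemma 6.19 and Cor. 6.20), with compactness replaced by its two consequences (i)–(ii).
[cite: ONeill1983, Ch. 5, Lemma 8] -/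
theorem isGeodesicallyComplete_of_uniformTime [CompleteSpace E] [T2Space M]
    [BoundarylessManifold I M] [CovariantDerivative.ContMDiffCovariantDerivative cov 1]
    (H : ∀ (x : M) (v : TangentSpace I x) (T : ℝ), 0 < T →
      ∃ (𝒦 : Set (TangentBundle I M)) (ε : ℝ), 0 < ε ∧
        (∀ p ∈ 𝒦, ∃ β : ℝ → M, IsGeodesicOn cov β (Ioo (-ε) ε) ∧ tangentLift I β 0 = p) ∧
        ∀ (γ : ℝ → M) (a b : ℝ), a < 0 → 0 < b → IsGeodesicOn cov γ (Ioo a b) → γ 0 = x →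
          velocity I γ 0 = v → ∀ t ∈ Ioo a b, |t| < T → tangentLift I γ t ∈ 𝒦) :
    IsGeodesicallyComplete cov := by
  intro x v
  set S : Set ℝ := {b : ℝ | 0 < b ∧ ∃ γ : ℝ → M, IsGeodesicOn cov γ (Ioo (-b) b) ∧ γ 0 = x ∧
    velocity I γ 0 = v} with hS_def
  -- `S` is nonempty (local existence) and an initial segment
  have hne : S.Nonempty := by
    obtain ⟨γ, s, hs, hγ, h0, hv0⟩ :=
      exists_isGeodesicOn_nhds_zero_holds (cov := cov) BoundarylessManifold.isInteriorPoint v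
    obtain ⟨b, hb, hbs⟩ := Metric.mem_nhds_iff.1 hs
    refine ⟨b, hb, γ, hγ.mono ?_, h0, hv0⟩
    rw [Real.ball_eq_Ioo, zero_sub, zero_add] at hbs
    exact hbs
  have hdown : ∀ b ∈ S, ∀ b', 0 < b' → b' ≤ b → b' ∈ S := by
    rintro b ⟨-, γ, hγ, h0, hv0⟩ b' hb' hb'b
    exact ⟨hb', γ, hγ.mono (Ioo_subset_Ioo (neg_le_neg hb'b) hb'b), h0, hv0⟩
  by_cases hbdd : BddAbove S
  · -- the bounded case is contradictory
    exfalso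
    set T := sSup S with hT_def
    have hTpos : 0 < T := by
      obtain ⟨b, hb⟩ := hne
      exact hb.1.trans_le (le_csSup hbdd hb)
    obtain ⟨𝒦, ε, hε, huni, hconf⟩ := H x v (T + 1) (by linarith)
    -- shrink the uniform time below `T`
    set ε' := min ε T with hε'_def
    have hε' : 0 < ε' := lt_min hε hTpos
    have hε'T : ε' ≤ T := min_le_right _ _
    have huni' : ∀ p ∈ 𝒦, ∃ β : ℝ → M, IsGeodesicOn cov β (Ioo (-ε') ε') ∧ tangentLift I β 0 = p :=
      fun p hp ↦ by
        obtain ⟨β, hβ, hβ0⟩ := huni p hp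
        exact ⟨β, hβ.mono (Ioo_subset_Ioo (neg_le_neg (min_le_left _ _)) (min_le_left _ _)), hβ0⟩
    -- a geodesic on `(-b, b)` with `b > T - ε'/2`
    obtain ⟨b, hbS, hTb⟩ := exists_lt_of_lt_csSup hne (show T - ε' / 2 < T by linarith)
    have hbT : b ≤ T := le_csSup hbdd hbS
    obtain ⟨hb, γ, hγ, h0, hv0⟩ := hbS
    have hbε : ε' / 2 < b := by linarith
    -- extend to the right at `t₁ = b - ε'/2`
    set t₁ := b - ε' / 2 with ht₁_def
    have ht₁ : t₁ ∈ Ioo (-b) b := ⟨by linarith, by linarith⟩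
    have hK₁ : tangentLift I γ t₁ ∈ 𝒦 :=
      hconf γ (-b) b (by linarith) hb hγ h0 hv0 t₁ ht₁ (abs_lt.2 ⟨by linarith, by linarith⟩)
    obtain ⟨β₁, hβ₁, hβ₁0⟩ := huni' _ hK₁
    obtain ⟨γ₁, hγ₁, hγ₁γ⟩ := hγ.exists_extend ht₁ hβ₁ hβ₁0
    have hI₁ : Ioo (-b) (b + ε' / 2) ⊆ Ioo (-b) b ∪ Ioo (t₁ - ε') (t₁ + ε') := by
      intro t ht
      by_cases htb : t < b
      · exact Or.inl ⟨ht.1, htb⟩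
      · refine Or.inr ⟨by linarith [ht.2], by linarith [ht.2]⟩
    replace hγ₁ := hγ₁.mono hI₁
    have h0₁ : γ₁ 0 = x := by rw [hγ₁γ ⟨by linarith, hb⟩, h0]
    have hv₁ : velocity I γ₁ 0 = v := by
      rw [← hv0]
      exact velocity_congr_of_eventuallyEq
        (Filter.eventuallyEq_of_mem (isOpen_Ioo.mem_nhds ⟨by linarith, hb⟩) hγ₁γ)
    -- extend to the left at `t₂ = -b + ε'/2`
    set t₂ := -b + ε' / 2 with ht₂_def
    have ht₂ : t₂ ∈ Ioo (-b) (b + ε' / 2) := ⟨by linarith, by linarith⟩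
    have hK₂ : tangentLift I γ₁ t₂ ∈ 𝒦 :=
      hconf γ₁ (-b) (b + ε' / 2) (by linarith) (by linarith) hγ₁ h0₁ hv₁ t₂ ht₂
        (abs_lt.2 ⟨by linarith, by linarith⟩)
    obtain ⟨β₂, hβ₂, hβ₂0⟩ := huni' _ hK₂
    obtain ⟨γ₂, hγ₂, hγ₂γ⟩ := hγ₁.exists_extend ht₂ hβ₂ hβ₂0
    have hI₂ : Ioo (-(b + ε' / 2)) (b + ε' / 2) ⊆
        Ioo (-b) (b + ε' / 2) ∪ Ioo (t₂ - ε') (t₂ + ε') := by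
      intro t ht
      by_cases htb : -b < t
      · exact Or.inl ⟨htb, ht.2⟩
      · refine Or.inr ⟨by linarith [ht.1], by linarith [ht.1]⟩
    replace hγ₂ := hγ₂.mono hI₂
    have h0₂ : γ₂ 0 = x := by rw [hγ₂γ ⟨by linarith, by linarith⟩, h0₁]
    have hv₂ : velocity I γ₂ 0 = v := by
      rw [← hv₁]
      exact velocity_congr_of_eventuallyEq
        (Filter.eventuallyEq_of_mem (isOpen_Ioo.mem_nhds ⟨by linarith, by linarith⟩) hγ₂γ)
    -- so `b + ε'/2 ∈ S`, exceeding the supremum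
    have hmem : b + ε' / 2 ∈ S := ⟨by linarith, γ₂, hγ₂, h0₂, hv₂⟩
    have := le_csSup hbdd hmem
    linarith
  · -- the unbounded case: geodesics on `(-n, n)` for all `n`
    refine exists_isGeodesic_of_forall_nat fun n ↦ ?_
    obtain ⟨b, hbS, hnb⟩ := not_bddAbove_iff.1 hbdd (n + 1)
    obtain ⟨-, γ, hγ, h0, hv0⟩ := hdown b hbS (n + 1) (by positivity) hnb.le
    exact ⟨γ, hγ, h0, hv0⟩

end Literature.Geometry.Lorentzian

end
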